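import Mathlib
import Summits.Ventures.HodgeRepro2.T5FiniteZerosUnion
import Summits.Ventures.HodgeRepro2.T5PropGBranchMeasure
import Summits.Ventures.HodgeRepro2.T5FiniteZerosExtension

/-!
# T5FiniteZerosExtensionUnion — S7 and the skeleton's `FinitelyManyZeros` for `W`-valued measures with
characters valued in `𝒪_{ℂ_p}`

Cell pub-hodge-repro2, Tier 5 support (seat p7; route/T5-CHECK-G-p7.md §3 S5 / S7 / §7(b)). The companion
of T5FiniteZerosExtension for the two consumers of S5 in the record:

* S7's union bound: for finitely many bounded `m_i ≠ 0` with values in the complete DVR `A` (the Katz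
  measures' `W`) and characters with values in a complete domain `R'` over `A` (`𝒪_{ℂ_p}`),
  `⋃_i Z_i(m_i ⊗ R')` is finite and `#(⋃_i Z_i) ≤ Σ_i λ(f_{m_i})` (`finite_biUnion_zeroSet_extend`,
  `ncard_biUnion_zeroSet_extend_le_sum_lambdaSeries`), so `(m_i ⊗ R')(κ) ≠ 0` for every `i` for all but
  finitely many `κ` (`eventually_forall_extend_ne_zero`);
* the skeleton's hypothesis `FinitelyManyZeros` (T5PropGSkeleton, discharged on the `R`-valued model by
  T5PropGBranchMeasure) holds for the branch data of the EXTENDED measure `m ⊗ R'` with `Ξ` the `R'`-valued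
  continuous characters (`finitelyManyZeros_branchData_extend`) — without asking `R'` to be a DVR
  (`𝒪_{ℂ_p}` is not one): Proposition G (i) for a branch, on the character ring where `Ξ_𝔭` lives, needs
  only S6's `InterpolationTransfer` — and `propG_extend` assembles Proposition G (i)–(iii) for the extended
  branch data from S6 and S8 alone (T5PropGSkeleton's `propG` with S5 discharged here).

Mathlib + own T5FiniteZerosUnion, T5PropGBranchMeasure, T5FiniteZerosExtension only.
-/

namespace Summit.Ventures.HodgeRepro2.T5FiniteZerosExtensionUnion

open PadicInt Filter Topology
open Summit.Ventures.HodgeRepro2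
open Summit.Ventures.HodgeRepro2.T5AmiceTransform
open Summit.Ventures.HodgeRepro2.T5LambdaInvariantDVR
open Summit.Ventures.HodgeRepro2.T5FiniteZerosExtension
open Summit.Ventures.HodgeRepro2.T5FiniteZerosUnion

variable {p : ℕ} [hp : Fact p.Prime]
variable {A : Type*} [NormedCommRing A] [Algebra ℤ_[p] A] [IsBoundedSMul ℤ_[p] A]
  [IsUltrametricDist A] [CompleteSpace A] [IsDomain A] [IsDiscreteValuationRing A]
  [IsAdicComplete (IsLocalRing.maximalIdeal A) A]
variable {R' : Type*} [NormedCommRing R'] [Algebra ℤ_[p] R'] [IsBoundedSMul ℤ_[p] R']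
  [IsUltrametricDist R'] [CompleteSpace R'] [IsLinearTopology R' R'] [IsDomain R'] [Algebra A R']

omit [IsUltrametricDist A] [CompleteSpace A] [IsDomain A] [IsDiscreteValuationRing A]
  [IsAdicComplete (IsLocalRing.maximalIdeal A) A] [IsLinearTopology R' R'] [IsDomain R'] in
/-- The zero set of `m ⊗ R'` on `R'`-valued characters is T5FiniteZerosUnion's `zeroSet` of the extended
functional. -/
theorem zeroSet_extend_eq (m : C(ℤ_[p], A) →ₗ[A] A) {C : ℝ} (hb : ∀ f, ‖m f‖ ≤ C * ‖f‖)
    (hφ : ∀ x : A, ‖algebraMap A R' x‖ ≤ ‖x‖) :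
    zeroSet (extend m hb hφ) =
      {κ : {κ : AddChar ℤ_[p] R' // Continuous κ} | extend m hb hφ ⟨κ.1, κ.2⟩ = 0} := rfl

/-- THE SKELETON'S `FinitelyManyZeros` for the extended branch data: `Ξ` = the `R'`-valued continuous
characters, `m` = `m ⊗ R'`, any `L` — for a bounded `m ≠ 0` with values in the complete DVR `A`. -/
theorem finitelyManyZeros_branchData_extend (m : C(ℤ_[p], A) →ₗ[A] A) {C : ℝ}
    (hb : ∀ f, ‖m f‖ ≤ C * ‖f‖) (hφ : ∀ x : A, ‖algebraMap A R' x‖ ≤ ‖x‖)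
    (hφi : Function.Injective (algebraMap A R')) (hne : m ≠ 0)
    (L : {κ : AddChar ℤ_[p] R' // Continuous κ} → ℂ) :
    T5PropGSkeleton.FinitelyManyZeros (T5PropGBranchMeasure.branchData (extend m hb hφ) L) :=
  finite_zeroSet_extend m hb hφ hφi hne

section Union

variable {ι : Type*}

/-- S7, finiteness, in the extension: `⋃_{i ∈ I} Z_i(m_i ⊗ R')` is finite. -/
theorem finite_biUnion_zeroSet_extend (I : Finset ι) (m : ι → (C(ℤ_[p], A) →ₗ[A] A)) (C : ι → ℝ)
    (hb : ∀ i, ∀ f, ‖m i f‖ ≤ C i * ‖f‖) (hφ : ∀ x : A, ‖algebraMap A R' x‖ ≤ ‖x‖)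
    (hφi : Function.Injective (algebraMap A R')) (hne : ∀ i ∈ I, m i ≠ 0) :
    (⋃ i ∈ I, zeroSet (extend (m i) (hb i) hφ)).Finite :=
  I.finite_toSet.biUnion fun i hi => finite_zeroSet_extend (m i) (hb i) hφ hφi (hne i hi)

/-- S7, the count, in the extension: `#(⋃_{i ∈ I} Z_i(m_i ⊗ R')) ≤ Σ_{i ∈ I} λ(f_{m_i})`, the λ-invariants
computed over `A = W`. -/
theorem ncard_biUnion_zeroSet_extend_le_sum_lambdaSeries (I : Finset ι)
    (m : ι → (C(ℤ_[p], A) →ₗ[A] A)) (C : ι → ℝ) (hb : ∀ i, ∀ f, ‖m i f‖ ≤ C i * ‖f‖)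
    (hφ : ∀ x : A, ‖algebraMap A R' x‖ ≤ ‖x‖) (hφi : Function.Injective (algebraMap A R'))
    (hne : ∀ i ∈ I, m i ≠ 0) :
    (⋃ i ∈ I, zeroSet (extend (m i) (hb i) hφ)).ncard ≤ ∑ i ∈ I, lambdaSeries (amice (m i)) :=
  calc (⋃ i ∈ I, zeroSet (extend (m i) (hb i) hφ)).ncard
      ≤ ∑ i ∈ I, (zeroSet (extend (m i) (hb i) hφ)).ncard :=
        ncard_biUnion_le_sum I fun i => zeroSet (extend (m i) (hb i) hφ)
    _ ≤ ∑ i ∈ I, lambdaSeries (amice (m i)) :=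
        Finset.sum_le_sum fun i hi =>
          ncard_zeroSet_extend_le_lambdaSeries (m i) (hb i) hφ hφi (hne i hi)

/-- S7, cofinite form, in the extension: for all but finitely many `R'`-valued continuous characters `κ`,
`(m_i ⊗ R')(κ) ≠ 0` for every `i ∈ I`. -/
theorem eventually_forall_extend_ne_zero (I : Finset ι) (m : ι → (C(ℤ_[p], A) →ₗ[A] A)) (C : ι → ℝ)
    (hb : ∀ i, ∀ f, ‖m i f‖ ≤ C i * ‖f‖) (hφ : ∀ x : A, ‖algebraMap A R' x‖ ≤ ‖x‖)
    (hφi : Function.Injective (algebraMap A R')) (hne : ∀ i ∈ I, m i ≠ 0) :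
    ∀ᶠ κ : {κ : AddChar ℤ_[p] R' // Continuous κ} in cofinite,
      ∀ i ∈ I, extend (m i) (hb i) hφ ⟨κ.1, κ.2⟩ ≠ 0 := by
  rw [Filter.eventually_cofinite]
  refine (finite_biUnion_zeroSet_extend I m C hb hφ hφi hne).subset ?_
  intro κ hκ
  simp only [Set.mem_setOf_eq, not_forall, not_not] at hκ
  obtain ⟨i, hi, h0⟩ := hκ
  exact Set.mem_biUnion hi h0

/-- Pigeonhole form: among more than `Σ_i λ(f_{m_i})` distinct `R'`-valued continuous characters, one is
killed by none of the `m_i ⊗ R'`. -/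
theorem exists_forall_extend_ne_zero_of_lt (I : Finset ι) (m : ι → (C(ℤ_[p], A) →ₗ[A] A)) (C : ι → ℝ)
    (hb : ∀ i, ∀ f, ‖m i f‖ ≤ C i * ‖f‖) (hφ : ∀ x : A, ‖algebraMap A R' x‖ ≤ ‖x‖)
    (hφi : Function.Injective (algebraMap A R')) (hne : ∀ i ∈ I, m i ≠ 0)
    (S : Finset {κ : AddChar ℤ_[p] R' // Continuous κ})
    (hS : ∑ i ∈ I, lambdaSeries (amice (m i)) < S.card) :
    ∃ κ ∈ S, ∀ i ∈ I, extend (m i) (hb i) hφ ⟨κ.1, κ.2⟩ ≠ 0 := by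
  by_contra h
  have h' : ∀ κ ∈ S, ∃ i ∈ I, extend (m i) (hb i) hφ ⟨κ.1, κ.2⟩ = 0 := fun κ hκ => by
    by_contra h2
    exact h ⟨κ, hκ, fun i hi h0 => h2 ⟨i, hi, h0⟩⟩
  have hsub : (↑S : Set {κ : AddChar ℤ_[p] R' // Continuous κ}) ⊆
      ⋃ i ∈ I, zeroSet (extend (m i) (hb i) hφ) := by
    intro κ hκ
    obtain ⟨i, hi, h0⟩ := h' κ (Finset.mem_coe.mp hκ)
    exact Set.mem_biUnion hi h0
  have h1 : S.card ≤ (⋃ i ∈ I, zeroSet (extend (m i) (hb i) hφ)).ncard := by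
    rw [← Set.ncard_coe_finset S]
    exact Set.ncard_le_ncard hsub (finite_biUnion_zeroSet_extend I m C hb hφ hφi hne)
  have h2 := ncard_biUnion_zeroSet_extend_le_sum_lambdaSeries I m C hb hφ hφi hne
  omega

/-- PROPOSITION G (i)–(iii) FOR THE EXTENDED BRANCH DATA (T5PropGSkeleton's `propG` with S5 discharged):
for finitely many bounded `m_i ≠ 0` with values in the complete DVR `A` (the four `𝔭`-line Katz measures)
and characters with values in a complete domain `R'` over `A` (`𝒪_{ℂ_p}`), given only S6
(`InterpolationTransfer`) and S8 (`SignConstant` + (R-sign)) per branch: every `L_i` vanishes on finitely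
many `ν`, the product vanishes on finitely many `ν`, and every sign is `+1`. -/
theorem propG_extend (I : Finset ι) (m : ι → (C(ℤ_[p], A) →ₗ[A] A)) (C : ι → ℝ)
    (hb : ∀ i, ∀ f, ‖m i f‖ ≤ C i * ‖f‖) (hφ : ∀ x : A, ‖algebraMap A R' x‖ ≤ ‖x‖)
    (hφi : Function.Injective (algebraMap A R')) (hne : ∀ i ∈ I, m i ≠ 0)
    (L : ι → {κ : AddChar ℤ_[p] R' // Continuous κ} → ℂ)
    (h6 : ∀ i ∈ I, T5PropGSkeleton.InterpolationTransfer
      (T5PropGBranchMeasure.branchData (extend (m i) (hb i) hφ) (L i)))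
    (eps : ι → {κ : AddChar ℤ_[p] R' // Continuous κ} → ℤ) (one : {κ : AddChar ℤ_[p] R' // Continuous κ})
    (h8 : ∀ i ∈ I, T5PropGSkeleton.SignConstant (eps i) one) (hsign : ∀ i ∈ I, eps i one = 1) :
    (∀ i ∈ I, T5PropGSkeleton.CofiniteNonvanishing
        (T5PropGBranchMeasure.branchData (extend (m i) (hb i) hφ) (L i))) ∧
      {ν | (∏ i ∈ I, (T5PropGBranchMeasure.branchData (extend (m i) (hb i) hφ) (L i)).L ν) = 0}.Finite ∧
      ∀ i ∈ I, ∀ ν, eps i ν = 1 :=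
  T5PropGSkeleton.propG I (fun i => T5PropGBranchMeasure.branchData (extend (m i) (hb i) hφ) (L i))
    (fun i hi => finitelyManyZeros_branchData_extend (m i) (hb i) hφ hφi (hne i hi) (L i)) h6 eps one
    h8 hsign

end Union

end Summit.Ventures.HodgeRepro2.T5FiniteZerosExtensionUnion
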